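import Literature.IUT.LogVolume.Corollary22Legendre
import Literature.IUT.LogVolume.Corollary22PartI
import Literature.IUT.LogVolume.Corollary22TwoAdicIntegrality
import Mathlib.FieldTheory.IntermediateField.Adjoin.Basic
import HarnessLib

/-!
# [IUTchIV] Corollary 2.2 (ii), proof: `λ`-line bookkeeping lemmas (classical)

Mochizuki, *Inter-universal Teichmüller theory IV*, RIMS manuscript (Apr. 2020; = PRIMS **57** (2021)),
Cor. 2.2, proof of (ii), pp. 43–48. Classical facts about the functions of `Corollary22Statement.lean` /
`Corollary22Legendre.lean` on points `x_E = λ` of the `λ`-line that the assembly `Corollary22PartII.lean`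
consumes; nothing disputed is used or asserted (TAKES NO SIDE on [IUTchIII] Cor. 3.12):

* the bad places are the places with `ord_v j(λ) < 0` (`mem_badPlaces_iff_ord_neg`); `h = log(q^∀) =
  (1/[F:ℚ])·Σ_v h_v·f_v·log(p_v)` (p. 44) as a finite sum over them (`degree_mul_logQAvoid`,
  `degree_mul_logQForall_eq_sum`);
* the (P3)-type estimate "`log(q^{∤S}) − log(q^{∤S∪{l}}) ≤ M·log(l)` when `h_v ≤ M` at the places over `l`"
  (`logQAvoid_sub_insert_le`; with (P3), `M = h^{1/2}`: p. 47 "`(1/6)·log(q^{∤2}) − (1/6)·log(q) ≤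
  (1/6)·h^{1/2}·log(l)`"); the passage from the natural-number form of (P2) delivered by the prime-choice
  step to `Cor22.CondP2` (`condP2_of_toNat`);
* `𝕍^bad_mod = ∅ ⟹ log(q) = 0` (`logQAvoid_pair_eq_zero_of_not_condP5`);
* points whose `j`-invariant is an algebraic integer (e.g. `j ∈ {0, 1728}`) have `log(q^∀) = 0`
  (`logQForall_eq_zero_of_isIntegral`), and `log(q^∀) ≤ k·log p` when `j = a/p^k` (`logQForall_le_of_jInv_eq_div`);
  hence `log(q^∀) ≤ 12` at the four exceptional `j`-invariants of [CanLift] Prop. 2.7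
  (`logQForall_le_of_not_admitsCore`) — the bound that puts them into `Exc_d` (p. 43);
* "`log(𝔣^{F_tpd}) ≤ log-cond_D(x_E)`" (p. 43, p. 48: "it follows immediately from the definitions"): every
  place with `ord_v j(λ) < 0` lies in the support of the conductor of `λ` at `[0]+[1]+[∞]`
  (`badPlaces_subset_condSupport`, `logCondAvoid_le_logCond`);
* `1 ≤ d_mod ≤ [F_tpd:ℚ]`, "`20·d_mod ≤ d*_mod ≤ δ`" (`dmod_pos`, `dmod_le_degree`, `dstar_le_delta`).
-/

noncomputable section

namespace Literature.IUT.LogVolume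

namespace Cor22

open NumberField IsDedekindDomain Real Polynomial Finset
open Literature.NumberTheory.DiophantineGeometry.GenEll

/-! ## Bad places and `log(q^{∤S})` as a finite sum -/

/-- The bad places of `λ` (poles of `j(λ)`, Mathlib's `Support`) are exactly the places with
`ord_v j(λ) < 0`. [claim: Mochizuki2012, status: disputed] -/
theorem mem_badPlaces_iff_ord_neg (P : NFPoint) (v : HeightOneSpectrum (𝓞 P.F)) :
    v ∈ badPlaces P ↔ ord P.F v (jInv P.x) < 0 := by
  classical
  unfold badPlaces
  rw [Set.Finite.mem_toFinset]
  unfold HeightOneSpectrum.Support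
  rw [Set.mem_setOf_eq]
  unfold ord
  by_cases h0 : v.valuation P.F (jInv P.x) = 0
  · rw [h0]; simp
  · rw [neg_lt_zero, ← WithZero.log_one, WithZero.log_lt_log one_ne_zero h0]

open scoped Classical in
/-- `[F_tpd:ℚ]·log(q^{∤S}(λ)) = Σ_{v bad, v ∤ S} h_v·log N(v)` (p. 44: "`h = (1/[F:ℚ])·Σ_v h_v·f_v·log(p_v)`",
here restricted to the places away from `S`). [claim: Mochizuki2012, status: disputed] -/
theorem degree_mul_logQAvoid (P : NFPoint) (S : Finset ℕ) :
    (P.degree : ℝ) * logQAvoid P S =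
      ∑ v ∈ (badPlaces P).filter (fun v => ∀ p ∈ S, ((p : ℕ) : 𝓞 P.F) ∉ v.asIdeal),
        localHeight P v * logNorm P.F v := by
  classical
  unfold logQAvoid qDivisor NFPoint.degree
  rw [FinDivisor.ndeg_apply, FinDivisor.deg_sum_of]
  have h0 : (0 : ℝ) < Module.finrank ℚ P.F := FinDivisor.finrank_pos
  rw [mul_div_cancel₀ _ h0.ne']

/-- `[F_tpd:ℚ]·h = Σ_{v bad} h_v·f_v·log(p_v)` with `h = log(q^∀)` (p. 44) — the shape consumed by the
prime-choice step (`PrimeChoiceData.h_def`). [claim: Mochizuki2012, status: disputed] -/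
theorem degree_mul_logQForall_eq_sum (P : NFPoint) :
    (P.degree : ℝ) * logQForall P =
      ∑ v ∈ badPlaces P, localHeight P v * (resDeg P.F v : ℝ) * Real.log (residueChar P.F v) := by
  classical
  have h := degree_mul_logQAvoid P ∅
  rw [Finset.filter_true_of_mem (fun v _ => by simp)] at h
  unfold logQForall
  rw [h]
  refine Finset.sum_congr rfl fun v _ => ?_
  rw [logNorm_eq]; ring

/-! ## The (P3)-type estimate and the form of (P2) -/

/-- For a prime `l` and `M ≥ 0` bounding the local heights at the bad places over `l`:
`log(q^{∤S}) − log(q^{∤(S∪{l})}) ≤ M·log(l)` — the difference is `(1/[F:ℚ])·Σ_{v∣l, v∤S, bad} h_v·f_v·log(l) ≤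
M·log(l)·(1/[F:ℚ])·Σ_{v∣l} f_v ≤ M·log(l)` by the fundamental identity `Σ_{v∣l} e_v f_v = [F:ℚ]`. With (P3)
("if `l = p_v` … then `h_v < h^{1/2}`") and `S = {2}` this is p. 47: "`(1/6)·log(q^{∤2}) − (1/6)·log(q) ≤
(1/6)·h^{1/2}·log(l)`". [claim: Mochizuki2012, status: disputed] -/
theorem logQAvoid_sub_insert_le (P : NFPoint) (S : Finset ℕ) {l : ℕ} (hl : l.Prime) {M : ℝ} (hM : 0 ≤ M)
    (hbound : ∀ v ∈ badPlaces P, ((l : ℕ) : 𝓞 P.F) ∈ v.asIdeal → localHeight P v ≤ M) :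
    logQAvoid P S - logQAvoid P (insert l S) ≤ M * Real.log l := by
  classical
  haveI : Fact l.Prime := ⟨hl⟩
  have hn : (0 : ℝ) < P.degree := by exact_mod_cast P.degree_pos
  -- multiply through by `[F:ℚ]`
  rw [← mul_le_mul_iff_of_pos_left hn, mul_sub, degree_mul_logQAvoid, degree_mul_logQAvoid]
  set A := (badPlaces P).filter (fun v => ∀ p ∈ S, ((p : ℕ) : 𝓞 P.F) ∉ v.asIdeal) with hA
  set g : HeightOneSpectrum (𝓞 P.F) → ℝ := fun v => localHeight P v * logNorm P.F v with hg
  -- the places away from `S ∪ {l}` are those of `A` not over `l`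
  have hsplit : (badPlaces P).filter (fun v => ∀ p ∈ insert l S, ((p : ℕ) : 𝓞 P.F) ∉ v.asIdeal) =
      A.filter (fun v => ((l : ℕ) : 𝓞 P.F) ∉ v.asIdeal) := by
    ext v
    simp only [hA, Finset.mem_filter, Finset.forall_mem_insert]
    tauto
  rw [hsplit]
  have hdecomp := Finset.sum_filter_add_sum_filter_not A (fun v => ((l : ℕ) : 𝓞 P.F) ∉ v.asIdeal) g
  have hdiff : ∑ v ∈ A, g v - ∑ v ∈ A.filter (fun v => ((l : ℕ) : 𝓞 P.F) ∉ v.asIdeal), g v =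
      ∑ v ∈ A.filter (fun v => ¬ ((l : ℕ) : 𝓞 P.F) ∉ v.asIdeal), g v := by linarith
  rw [hdiff]
  -- termwise bound on the places over `l`, then enlarge to all places over `l`
  have hg0 : ∀ v, 0 ≤ M * ((resDeg P.F v : ℝ) * Real.log l) := fun v => by
    have : (0 : ℝ) ≤ Real.log l := Real.log_natCast_nonneg l
    positivity
  calc ∑ v ∈ A.filter (fun v => ¬ ((l : ℕ) : 𝓞 P.F) ∉ v.asIdeal), g v
      ≤ ∑ v ∈ A.filter (fun v => ¬ ((l : ℕ) : 𝓞 P.F) ∉ v.asIdeal), M * ((resDeg P.F v : ℝ) * Real.log l) := by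
        refine Finset.sum_le_sum fun v hv => ?_
        rw [Finset.mem_filter, not_not] at hv
        have hvbad : v ∈ badPlaces P := (Finset.mem_filter.mp hv.1).1
        have hvl : v ∈ placesOver P.F l := mem_placesOver_of_natCast_mem l v hv.2
        have hchar : residueChar P.F v = l := (mem_placesOver_iff_residueChar v).mp hvl
        rw [hg]; dsimp only
        rw [logNorm_eq, hchar]
        have h1 := hbound v hvbad hv.2
        have h2 : (0 : ℝ) ≤ (resDeg P.F v : ℝ) * Real.log l := by
          have : (0 : ℝ) ≤ Real.log l := Real.log_natCast_nonneg l
          positivity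
        nlinarith
    _ ≤ ∑ v ∈ placesOver P.F l, M * ((resDeg P.F v : ℝ) * Real.log l) := by
        refine Finset.sum_le_sum_of_subset_of_nonneg (fun v hv => ?_) (fun v _ _ => hg0 v)
        rw [Finset.mem_filter, not_not] at hv
        exact mem_placesOver_of_natCast_mem l v hv.2
    _ = M * Real.log l * ∑ v ∈ placesOver P.F l, (resDeg P.F v : ℝ) := by
        rw [Finset.mul_sum]; refine Finset.sum_congr rfl fun v _ => by ring
    _ ≤ M * Real.log l * (P.degree : ℝ) := by
        refine mul_le_mul_of_nonneg_left ?_ (by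
          have : (0 : ℝ) ≤ Real.log l := Real.log_natCast_nonneg l
          positivity)
        have hsum := sum_localDegree P.F l
        have hle : ∑ v ∈ placesOver P.F l, resDeg P.F v ≤ ∑ v ∈ placesOver P.F l, localDegree P.F v :=
          Finset.sum_le_sum fun v _ => by
            unfold localDegree
            exact Nat.le_mul_of_pos_left _ (Nat.pos_of_ne_zero (ramIdx_ne_zero P.F v))
        rw [hsum] at hle
        unfold NFPoint.degree
        exact_mod_cast hle
    _ = (P.degree : ℝ) * (M * Real.log l) := by ring

/-- From the natural-number form of (P2) delivered by the prime-choice step ("`l` does not divide any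
nonzero `h_v`", `h_v = max(0, −ord_v j(λ))`) to `Cor22.CondP2` (`l ∤ ord_v j(λ)` whenever `ord_v j(λ) < 0`).
[claim: Mochizuki2012, status: disputed] -/
theorem condP2_of_toNat {P : NFPoint} {l : ℕ}
    (h : ∀ v ∈ badPlaces P, (-(ord P.F v (jInv P.x))).toNat ≠ 0 → ¬ l ∣ (-(ord P.F v (jInv P.x))).toNat) :
    CondP2 P l := by
  intro v hv hdvd
  have hvb : v ∈ badPlaces P := (mem_badPlaces_iff_ord_neg P v).mpr hv
  set o := ord P.F v (jInv P.x) with ho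
  have hpos : 0 < -o := by omega
  have hne : (-o).toNat ≠ 0 := by
    intro h0; rw [Int.toNat_eq_zero] at h0; omega
  refine h v hvb hne ?_
  have hcast : (((-o).toNat : ℕ) : ℤ) = -o := Int.toNat_of_nonneg hpos.le
  have : (l : ℤ) ∣ (((-o).toNat : ℕ) : ℤ) := by rw [hcast]; exact (dvd_neg).mpr hdvd
  exact_mod_cast this

/-! ## (P5) and `log(q)` -/

/-- If `𝕍^bad_mod = ∅`, i.e. no place `v ∤ 2l` has `ord_v j(λ) < 0`, then `log(q) = log(q^{∤{2,l}}) = 0`.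
[claim: Mochizuki2012, status: disputed] -/
theorem logQAvoid_pair_eq_zero_of_not_condP5 {P : NFPoint} {l : ℕ} (h : ¬ CondP5 P l) :
    logQAvoid P {2, l} = 0 := by
  classical
  unfold CondP5 at h
  unfold logQAvoid qDivisor
  rw [Finset.filter_false_of_mem, Finset.sum_empty, map_zero]
  intro v hv hall
  have h2 : ((2 : ℕ) : 𝓞 P.F) ∉ v.asIdeal := hall 2 (by simp)
  have hl : ((l : ℕ) : 𝓞 P.F) ∉ v.asIdeal := hall l (by simp)
  exact h ⟨v, (mem_badPlaces_iff_ord_neg P v).mp hv, h2, hl⟩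

/-! ## Integral and exceptional `j`-invariants -/

/-- If `j(λ)` is an algebraic integer then `λ` has no bad places (no poles of `j`).
[claim: Mochizuki2012, status: disputed] -/
theorem badPlaces_eq_empty_of_isIntegral {P : NFPoint} (h : IsIntegral ℤ (jInv P.x)) : badPlaces P = ∅ := by
  classical
  unfold badPlaces
  rw [Set.Finite.toFinset_eq_empty]
  ext v
  simp only [HeightOneSpectrum.Support, Set.mem_setOf_eq, Set.mem_empty_iff_false, iff_false, not_lt]
  set z : 𝓞 P.F := ⟨jInv P.x, (mem_integralClosure_iff _ _).mpr h⟩ with hz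
  have : (z : P.F) = jInv P.x := rfl
  rw [← this]
  exact v.valuation_le_one z

/-- `log(q^{∤S}(λ)) = 0` when `j(λ)` is an algebraic integer. [claim: Mochizuki2012, status: disputed] -/
theorem logQAvoid_eq_zero_of_isIntegral {P : NFPoint} (h : IsIntegral ℤ (jInv P.x)) (S : Finset ℕ) :
    logQAvoid P S = 0 := by
  classical
  unfold logQAvoid qDivisor
  rw [badPlaces_eq_empty_of_isIntegral h, Finset.filter_empty, Finset.sum_empty, map_zero]

/-- `log(q^∀(λ)) = 0` when `j(λ)` is an algebraic integer. [claim: Mochizuki2012, status: disputed] -/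
theorem logQForall_eq_zero_of_isIntegral {P : NFPoint} (h : IsIntegral ℤ (jInv P.x)) : logQForall P = 0 :=
  logQAvoid_eq_zero_of_isIntegral h ∅

/-- The points "corresponding to elliptic curves that admit automorphisms of order `> 2`" (p. 42), i.e.
`j ∈ {0, 1728}`, have `log(q^∀) = 0`. [claim: Mochizuki2012, status: disputed] -/
theorem logQForall_eq_zero_of_jInv_zero_or_1728 {P : NFPoint} (h : jInv P.x = 0 ∨ jInv P.x = 1728) :
    logQForall P = 0 := by
  apply logQForall_eq_zero_of_isIntegral
  rcases h with h | h
  · rw [h]; exact isIntegral_zero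
  · rw [h]
    have : ((1728 : ℤ) : P.F) = 1728 := by norm_cast
    rw [← this]
    exact isIntegral_algebraMap

/-- `log(q^∀(λ)) ≤ k·log(p)` when `j(λ) = a/p^k` with `a ∈ ℤ`, `p` prime: the poles of `j` lie over `p` with
`−ord_v j ≤ k·e_v`, and `Σ_{v∣p} e_v f_v = [F:ℚ]`. [claim: Mochizuki2012, status: disputed] -/
theorem logQForall_le_of_jInv_eq_div (P : NFPoint) {a : ℤ} {p : ℕ} (hp : p.Prime) (k : ℕ)
    (hj : jInv P.x = (a : P.F) / (p : P.F) ^ k) : logQForall P ≤ k * Real.log p := by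
  classical
  haveI : Fact p.Prime := ⟨hp⟩
  by_cases ha : a = 0
  · rw [ha, Int.cast_zero, zero_div] at hj
    rw [logQForall_eq_zero_of_jInv_zero_or_1728 (Or.inl hj)]
    have : (0 : ℝ) ≤ Real.log p := Real.log_natCast_nonneg p
    positivity
  have hn : (0 : ℝ) < P.degree := by exact_mod_cast P.degree_pos
  have hp0 : (p : P.F) ≠ 0 := by exact_mod_cast hp.ne_zero
  have ha0 : (a : P.F) ≠ 0 := by exact_mod_cast ha
  -- `−ord_v j ≤ k·ord_v(p)`, and `ord_v(p) = e_v` over `p`, `0` elsewhere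
  have hord : ∀ v : HeightOneSpectrum (𝓞 P.F), -(ord P.F v (jInv P.x)) ≤ k * ord P.F v (p : P.F) := by
    intro v
    rw [hj, div_eq_mul_inv, ord_mul P.F v ha0 (inv_ne_zero (pow_ne_zero _ hp0)), ord_inv, ord_pow]
    have : 0 ≤ ord P.F v (a : P.F) := by
      have := ord_nonneg_of_isIntegral P.F v (a : 𝓞 P.F)
      simpa using this
    linarith
  have hloc : ∀ v : HeightOneSpectrum (𝓞 P.F), localHeight P v ≤ k * (ord P.F v (p : P.F) : ℝ) := by
    intro v
    have hk0 : 0 ≤ (k : ℤ) * ord P.F v (p : P.F) := by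
      have := ord_nonneg_of_isIntegral P.F v (p : 𝓞 P.F)
      have h' : 0 ≤ ord P.F v (p : P.F) := by simpa using this
      positivity
    unfold localHeight
    have h1 : ((-(ord P.F v (jInv P.x))).toNat : ℤ) ≤ k * ord P.F v (p : P.F) := by
      rcases le_or_gt 0 (-(ord P.F v (jInv P.x))) with h | h
      · rw [Int.toNat_of_nonneg h]; exact hord v
      · rw [Int.toNat_of_nonpos h.le]; simpa using hk0
    have h2 : (((-(ord P.F v (jInv P.x))).toNat : ℤ) : ℝ) ≤ ((k * ord P.F v (p : P.F) : ℤ) : ℝ) := by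
      exact_mod_cast h1
    push_cast at h2
    exact_mod_cast h2
  -- sum over the bad places, enlarge to the places over `p`
  rw [← mul_le_mul_iff_of_pos_left hn, degree_mul_logQForall_eq_sum]
  have hterm : ∀ v ∈ badPlaces P,
      localHeight P v * (resDeg P.F v : ℝ) * Real.log (residueChar P.F v) ≤
        (if v ∈ placesOver P.F p then k * (localDegree P.F v : ℝ) * Real.log p else 0) := by
    intro v _
    split_ifs with hvp
    · have hchar : residueChar P.F v = p := (mem_placesOver_iff_residueChar v).mp hvp
      rw [hchar]
      have he : (ord P.F v (p : P.F) : ℝ) = ramIdx P.F v := by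
        rw [ord_natCast_eq_ramIdx p v hvp]; norm_cast
      have h1 := hloc v
      rw [he] at h1
      have hlog : (0 : ℝ) ≤ Real.log p := Real.log_natCast_nonneg p
      have hf : (0 : ℝ) ≤ resDeg P.F v := Nat.cast_nonneg _
      unfold localDegree
      push_cast
      nlinarith [mul_nonneg hf hlog]
    · -- `v ∤ p`: `p` is a unit at `v`, so `ord_v(p) = 0` and `h_v = 0`
      have hnot : (p : 𝓞 P.F) ∉ v.asIdeal := fun hmem => hvp (mem_placesOver_of_natCast_mem p v hmem)
      have hval : v.valuation P.F ((p : 𝓞 P.F) : P.F) = 1 := (v.valuation_eq_one_iff_notMem).mpr hnot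
      have hordp : ord P.F v (p : P.F) = 0 := by
        unfold ord
        have : ((p : 𝓞 P.F) : P.F) = (p : P.F) := by simp
        rw [← this, hval, WithZero.log_one, neg_zero]
      have h1 := hloc v
      rw [hordp] at h1
      push_cast at h1
      rw [mul_zero] at h1
      have h0 : localHeight P v = 0 := le_antisymm h1 (localHeight_nonneg P v)
      rw [h0, zero_mul, zero_mul]
  calc ∑ v ∈ badPlaces P, localHeight P v * (resDeg P.F v : ℝ) * Real.log (residueChar P.F v)
      ≤ ∑ v ∈ badPlaces P, (if v ∈ placesOver P.F p then k * (localDegree P.F v : ℝ) * Real.log p else 0) :=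
        Finset.sum_le_sum hterm
    _ ≤ ∑ v ∈ placesOver P.F p, (k * (localDegree P.F v : ℝ) * Real.log p) := by
        rw [← Finset.sum_filter]
        refine Finset.sum_le_sum_of_subset_of_nonneg (fun v hv => (Finset.mem_filter.mp hv).2) ?_
        intro v _ _
        have : (0 : ℝ) ≤ Real.log p := Real.log_natCast_nonneg p
        positivity
    _ = k * Real.log p * ∑ v ∈ placesOver P.F p, (localDegree P.F v : ℝ) := by
        rw [Finset.mul_sum]; exact Finset.sum_congr rfl fun v _ => by ring
    _ = (P.degree : ℝ) * (k * Real.log p) := by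
        have := sum_localDegree P.F p
        unfold NFPoint.degree
        rw [← this]; push_cast; ring

/-- At the four exceptional `j`-invariants of [CanLift] Prop. 2.7 (`coreExceptionalJ = {2^14·31^3/5^3,
2^2·73^3/3^4, 1728, 0}`), `log(q^∀) ≤ 12` (indeed `≤ 3·log 5`): the bound that puts the curves without
`F`-core into `Exc_d` (p. 43). [claim: Mochizuki2012, status: disputed] -/
theorem logQForall_le_of_not_admitsCore {P : NFPoint} (h : ¬ AdmitsCore P) : logQForall P ≤ 12 := by
  unfold AdmitsCore at h
  push Not at h
  obtain ⟨q, hq, hj⟩ := h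
  have hlog5 : Real.log 5 ≤ 4 := by
    have := Real.log_le_sub_one_of_pos (show (0 : ℝ) < 5 by norm_num); linarith
  have hlog3 : Real.log 3 ≤ 2 := by
    have := Real.log_le_sub_one_of_pos (show (0 : ℝ) < 3 by norm_num); linarith
  simp only [coreExceptionalJ, Finset.mem_insert, Finset.mem_singleton] at hq
  rcases hq with rfl | rfl | rfl | rfl
  · have hj' : jInv P.x = ((488095744 : ℤ) : P.F) / ((5 : ℕ) : P.F) ^ 3 := by
      rw [hj]; push_cast; norm_num
    have := logQForall_le_of_jInv_eq_div P Nat.prime_five 3 hj'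
    push_cast at this
    linarith
  · have hj' : jInv P.x = ((1556068 : ℤ) : P.F) / ((3 : ℕ) : P.F) ^ 4 := by
      rw [hj]; push_cast; norm_num
    have := logQForall_le_of_jInv_eq_div P Nat.prime_three 4 hj'
    push_cast at this
    linarith
  · have : jInv P.x = 1728 := by rw [hj]; push_cast; norm_num
    rw [logQForall_eq_zero_of_jInv_zero_or_1728 (Or.inr this)]; norm_num
  · have : jInv P.x = 0 := by rw [hj]; push_cast; norm_num
    rw [logQForall_eq_zero_of_jInv_zero_or_1728 (Or.inl this)]; norm_num

/-! ## `log(𝔣^{F_tpd}) ≤ log-cond_D(x_E)` -/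

/-- Every bad place of `λ` (a pole of `j(λ) = 2^8(λ²−λ+1)³/(λ²(λ−1)²)`) lies in the support of the conductor
of `λ` at `D = [0]+[1]+[∞]`: if `λ` and `λ − 1` are `v`-units then `j(λ)` is `v`-integral (p. 43/48:
"`log(𝔣^{F_tpd}) ≤ log-cond_D(x_E)` … follows immediately from the definitions").
[claim: Mochizuki2012, status: disputed] -/
theorem badPlaces_subset_condSupport (P : NFPoint) {v : HeightOneSpectrum (𝓞 P.F)}
    (hv : v ∈ badPlaces P) : v ∈ P.condSupport := by
  classical
  unfold badPlaces at hv
  rw [Set.Finite.mem_toFinset] at hv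
  unfold HeightOneSpectrum.Support at hv
  rw [Set.mem_setOf_eq] at hv
  by_contra hnot
  unfold NFPoint.condSupport at hnot
  simp only [Set.mem_setOf_eq, not_or, not_lt] at hnot
  obtain ⟨h1, h2, h3⟩ := hnot
  set w := v.valuation P.F with hw
  have hx : w P.x = 1 := le_antisymm h2 h1
  have hx1 : w (P.x - 1) = 1 := by
    refine le_antisymm ?_ h3
    calc w (P.x - 1) ≤ max (w P.x) (w 1) := Valuation.map_sub w _ _
      _ = 1 := by rw [hx, map_one, max_self]
  -- numerator and the factor `2^8` are integral, the denominator is a unit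
  have hnum : w (P.x ^ 2 - P.x + 1) ≤ 1 := by
    have e : P.x ^ 2 - P.x + 1 = P.x * (P.x - 1) + 1 := by ring
    rw [e]
    calc w (P.x * (P.x - 1) + 1) ≤ max (w (P.x * (P.x - 1))) (w 1) := Valuation.map_add w _ _
      _ = 1 := by rw [map_mul, hx, hx1, map_one, one_mul, max_self]
  have h2 : w 2 ≤ 1 := by
    have : ((2 : 𝓞 P.F) : P.F) = 2 := rfl
    rw [← this]
    exact v.valuation_le_one _
  have hden : w (P.x ^ 2 * (P.x - 1) ^ 2) = 1 := by
    rw [map_mul, map_pow, map_pow, hx, hx1, one_pow, one_mul]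
  have hj : w (jInv P.x) ≤ 1 := by
    unfold jInv
    rw [map_div₀, hden, div_one, map_mul, map_pow, map_pow]
    calc w 2 ^ 8 * w (P.x ^ 2 - P.x + 1) ^ 3 ≤ 1 * 1 :=
          mul_le_mul' (pow_le_one₀ zero_le h2) (pow_le_one₀ zero_le hnum)
      _ = 1 := one_mul 1
  exact absurd hv (not_lt.mpr hj)

/-- `log(𝔣^{∤S}(λ)) ≥ 0`. [claim: Mochizuki2012, status: disputed] -/
theorem logCondAvoid_nonneg (P : NFPoint) (S : Finset ℕ) : 0 ≤ logCondAvoid P S := by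
  classical
  unfold logCondAvoid condDivisor
  apply FinDivisor.ndeg_nonneg
  intro v
  rw [Finset.sum_apply']
  exact Finset.sum_nonneg fun w _ => by
    unfold FinDivisor.of
    rw [Finsupp.single_apply]
    split_ifs <;> norm_num

/-- **"`log(𝔣^{F_tpd}) ≤ log-cond_D(x_E)`"** (p. 43; p. 48 "it follows immediately from the definitions"):
the conductor divisor away from any `S` is dominated by the conductor `(D_x)_red` of `λ` at `[0]+[1]+[∞]`,
both normalized by `[F_tpd:ℚ]`. [claim: Mochizuki2012, status: disputed] -/
theorem logCondAvoid_le_logCond (P : NFPoint) (hP : P.InU) (S : Finset ℕ) :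
    logCondAvoid P S ≤ P.logCond := by
  classical
  have hfin := P.condSupport_finite hP
  have hn : (0 : ℝ) < P.degree := by exact_mod_cast P.degree_pos
  -- the conductor as a finite sum of `log N(v)`
  have hcond : P.logCond = (P.degree : ℝ)⁻¹ * ∑ v ∈ hfin.toFinset, logNorm P.F v := by
    unfold NFPoint.logCond
    congr 1
    rw [finprod_mem_eq_finite_toFinset_prod _ hfin, Nat.cast_prod, Real.log_prod]
    · rfl
    · intro v _
      have : 1 < Ideal.absNorm v.asIdeal := NumberField.HeightOneSpectrum.one_lt_absNorm v
      exact_mod_cast (by omega : Ideal.absNorm v.asIdeal ≠ 0)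
  have hav : logCondAvoid P S =
      (P.degree : ℝ)⁻¹ * ∑ v ∈ (badPlaces P).filter (fun v => ∀ p ∈ S, ((p : ℕ) : 𝓞 P.F) ∉ v.asIdeal),
        logNorm P.F v := by
    unfold logCondAvoid condDivisor NFPoint.degree
    rw [FinDivisor.ndeg_apply, FinDivisor.deg_sum_of, div_eq_inv_mul]
    congr 1
    exact Finset.sum_congr rfl fun v _ => one_mul _
  rw [hcond, hav]
  refine mul_le_mul_of_nonneg_left ?_ (inv_nonneg.mpr hn.le)
  refine Finset.sum_le_sum_of_subset_of_nonneg (fun v hv => ?_) (fun v _ _ => (logNorm_pos P.F v).le)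
  rw [Set.Finite.mem_toFinset]
  exact badPlaces_subset_condSupport P (Finset.mem_filter.mp hv).1

/-! ## `d_mod` -/

/-- `j(λ)` is algebraic (integral over `ℚ`). [folklore] -/
private theorem isIntegral_jInv (P : NFPoint) : IsIntegral ℚ (jInv P.x) := Algebra.IsIntegral.isIntegral _

/-- `d_mod = [ℚ(j(λ)):ℚ]` is the degree of the minimal polynomial of `j(λ)`. [claim: Mochizuki2012, status: disputed] -/
theorem dmod_eq_natDegree (P : NFPoint) : dmod P = (minpoly ℚ (jInv P.x)).natDegree :=
  IntermediateField.adjoin.finrank (isIntegral_jInv P)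

/-- `d_mod ≥ 1`. [claim: Mochizuki2012, status: disputed] -/
theorem dmod_pos (P : NFPoint) : 1 ≤ dmod P := by
  rw [dmod_eq_natDegree]; exact minpoly.natDegree_pos (isIntegral_jInv P)

/-- `d_mod = [F_mod:ℚ] ≤ [F_tpd:ℚ]` (`F_mod ⊆ F_tpd`). [claim: Mochizuki2012, status: disputed] -/
theorem dmod_le_degree (P : NFPoint) : dmod P ≤ P.degree := by
  rw [dmod_eq_natDegree]; exact minpoly.natDegree_le (jInv P.x)

/-- "`20·d_mod ≤ d*_mod ≤ δ`" (p. 47) and "`e*_mod ≤ d*_mod`" (p. 22) for a point of degree `≤ d`: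
`d*_mod = 2^12·3^3·5·d_mod ≤ 2^12·3^3·5·d = δ`. [claim: Mochizuki2012, status: disputed] -/
theorem dstar_le_delta (P : NFPoint) {d : ℕ} (hd : P.degree ≤ d) :
    2 ^ 12 * 3 ^ 3 * 5 * (dmod P : ℝ) ≤ delta d := by
  unfold delta
  have : (dmod P : ℝ) ≤ d := by exact_mod_cast (dmod_le_degree P).trans hd
  nlinarith

/-- `20·d_mod ≤ δ` for a point of degree `≤ d` (p. 47). [claim: Mochizuki2012, status: disputed] -/
theorem twenty_dmod_le (P : NFPoint) {d : ℕ} (hd : P.degree ≤ d) : 20 * (dmod P : ℝ) ≤ delta d := by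
  unfold delta
  have : (dmod P : ℝ) ≤ d := by exact_mod_cast (dmod_le_degree P).trans hd
  nlinarith

end Cor22

end Literature.IUT.LogVolume

end
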